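import Mathlib.FieldTheory.SeparablyGenerated
import Mathlib.RingTheory.Flat.Basic
import Mathlib.RingTheory.TensorProduct.Free
import Mathlib.LinearAlgebra.TensorProduct.Finiteness
import Mathlib.Algebra.CharP.Algebra
import Mathlib.RingTheory.Nilpotent.Defs
import HarnessLib

/-!
# MacLane's condition (2) implies: the base change to a purely inseparable extension is reduced

Topic: `Literature/FieldTheory/Separability` (MacLane's criterion, Stacks 030W / Matsumura
Thm. 26.2: for a field extension `K/k` of characteristic `p` the conditions (1) separably
generated, (2) "`p`-th powers of `k`-linearly independent elements are `k`-linearly independent",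
(3) "`K ⊗ₖ k^{1/p}` is reduced", (4) geometrically reduced, are equivalent; Mathlib
(`Mathlib.FieldTheory.SeparablyGenerated`) proves (2) ⇒ (1), and the tree proves
"formally smooth ⇒ (2)" (`Literature.FieldTheory.Separability.linearIndepOn_pow_of_formallySmooth`)).
This file PROVES the elementary implication **(2) ⇒ (3)** in the flexible form used for
geometric reducedness arguments: if `K/k` satisfies (2), then `k' ⊗ₖ K` is reduced for every
reduced `k`-algebra `k'` all of whose elements have some `pⁿ`-th power in `k` (e.g. a purely
inseparable extension field, or the perfect closure of `k`):
`isReduced_tensorProduct_of_linearIndepOn_pow`. Proof: write a nilpotent `x = Σ mᵢ ⊗ bᵢ` on a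
`k`-basis `(bᵢ)` of a finite-dimensional subspace; for `q = p^M` large,
`0 = x^q = Σ mᵢ^q ⊗ bᵢ^q = 1 ⊗ Σ μᵢ bᵢ^q` with `μᵢ ∈ k`, and the `bᵢ^q` are independent by
(2) iterated, so `μᵢ = 0`, `mᵢ^q = 0`, `mᵢ = 0`. [folklore]; no named facts (D-0026).

## References

* The Stacks Project, Tag 030W ((2) ⇒ (3)). [StacksProject]
* H. Matsumura, *Commutative Ring Theory*, CUP 1986, Thm. 26.2 (MacLane). [Matsumura1987]
-/

noncomputable section

open scoped TensorProduct

namespace Literature.FieldTheory.Separability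

universe u v w

variable {k : Type u} {K : Type v} [Field k] [Field K] [Algebra k K] (p : ℕ) [Fact p.Prime] [CharP k p]
  (H : ∀ s : Finset K, LinearIndepOn k _root_.id (s : Set K) → LinearIndepOn k (· ^ p) (s : Set K))

omit [Fact p.Prime] [CharP k p] in
include H in
/-- MacLane's condition (2) iterated: `p^M`-th powers of `k`-linearly independent elements are
`k`-linearly independent. [folklore] -/
theorem linearIndepOn_pow_pow (M : ℕ) (s : Finset K) (hs : LinearIndepOn k _root_.id (s : Set K)) :
    LinearIndepOn k (· ^ p ^ M) (s : Set K) := by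
  classical
  induction M with
  | zero => exact (linearIndepOn_congr (fun x _ => by simp)).mp hs
  | succ M ih =>
    have hinj : Set.InjOn (fun x : K => x ^ p ^ M) (s : Set K) := ih.injOn
    have h1 : LinearIndepOn k _root_.id ((s.image fun x : K => x ^ p ^ M : Finset K) : Set K) := by
      rw [Finset.coe_image]
      exact ih.id_image
    have h2 := H _ h1
    rw [Finset.coe_image] at h2
    have h3 := h2.comp_of_image hinj
    refine (linearIndepOn_congr (fun x _ => ?_)).mp h3
    change (x ^ p ^ M) ^ p = x ^ p ^ (M + 1)
    rw [← pow_mul, ← pow_succ]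

omit [Fact p.Prime] [CharP k p] in
include H in
/-- Family form: for a `k`-linearly independent finite family `v` in `K`, the family `v i ^ p^M`
is `k`-linearly independent. [folklore] -/
theorem linearIndependent_pow_pow (M : ℕ) {ι : Type w} [Fintype ι] (v : ι → K)
    (hv : LinearIndependent k v) : LinearIndependent k fun i => v i ^ p ^ M := by
  classical
  have hinj : Function.Injective v := hv.injective
  have h1 : LinearIndepOn k _root_.id ((Finset.univ.image v : Finset K) : Set K) := by
    rw [Finset.coe_image, Finset.coe_univ, Set.image_univ]
    exact hv.linearIndepOn_id
  have h2 := linearIndepOn_pow_pow p H M _ h1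
  rw [Finset.coe_image, Finset.coe_univ] at h2
  have h3 := h2.comp_of_image (hinj.injOn)
  exact linearIndepOn_univ_iff.mp h3

include H in
/-- **MacLane (2) ⇒ (3)**: if `p`-th powers of `k`-linearly independent elements of `K` are
`k`-linearly independent, then `k' ⊗ₖ K` is reduced for every reduced `k`-algebra `k'` whose
elements all have some `pⁿ`-th power in `k` (purely inseparable extensions, the perfect
closure). [cite: StacksProject, Tag 030W] -/
theorem isReduced_tensorProduct_of_linearIndepOn_pow (k' : Type w) [CommRing k'] [Algebra k k']
    [IsReduced k'] (hk' : ∀ x : k', ∃ (n : ℕ) (y : k), algebraMap k k' y = x ^ p ^ n) :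
    IsReduced (k' ⊗[k] K) := by
  classical
  rcases subsingleton_or_nontrivial k' with hk0 | hk0
  · haveI : Subsingleton (k' ⊗[k] K) := by
      refine ⟨fun a b => ?_⟩
      rw [← one_mul a, ← one_mul b, show (1 : k' ⊗[k] K) = 0 from ?_, zero_mul, zero_mul]
      change (1 : k') ⊗ₜ[k] (1 : K) = 0
      rw [Subsingleton.elim (1 : k') 0, TensorProduct.zero_tmul]
    exact ⟨fun x _ => Subsingleton.elim _ _⟩
  have hinjk : Function.Injective (algebraMap k k') := (algebraMap k k').injective
  -- the characteristic exponent of `k' ⊗ K`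
  have hinjT : Function.Injective (Algebra.TensorProduct.includeRight : K →ₐ[k] k' ⊗[k] K) :=
    Algebra.TensorProduct.includeRight_injective hinjk
  haveI : Nontrivial (k' ⊗[k] K) := hinjT.nontrivial
  haveI : CharP (k' ⊗[k] K) p :=
    charP_of_injective_algebraMap (algebraMap k (k' ⊗[k] K)).injective p
  haveI : ExpChar (k' ⊗[k] K) p := ExpChar.prime (Fact.out : p.Prime)
  refine ⟨fun x hx => ?_⟩
  obtain ⟨e, he⟩ := hx
  -- write `x` with right factors in a finite-dimensional subspace `V`
  obtain ⟨S, hS⟩ := TensorProduct.exists_finset x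
  let V : Submodule k K := Submodule.span k ((S.image Prod.snd : Finset K) : Set K)
  haveI : Module.Finite k V := Module.Finite.span_of_finite k (Finset.finite_toSet _)
  obtain ⟨y, hyx⟩ : ∃ y : k' ⊗[k] V, LinearMap.lTensor k' V.subtype y = x := by
    refine ⟨∑ i ∈ S.attach, i.1.1 ⊗ₜ[k] ⟨i.1.2, Submodule.subset_span ?_⟩, ?_⟩
    · exact Finset.mem_coe.mpr (Finset.mem_image_of_mem _ i.2)
    · rw [map_sum, hS, ← Finset.sum_attach S]
      refine Finset.sum_congr rfl fun i _ => ?_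
      rw [LinearMap.lTensor_tmul]
      rfl
  -- coordinates on a basis
  let b := Module.finBasis k V
  let B := Algebra.TensorProduct.basis k' b
  let m : Fin (Module.finrank k V) → k' := fun i => B.repr y i
  have hy : y = ∑ i, m i ⊗ₜ[k] (b i) := by
    conv_lhs => rw [← B.sum_repr y]
    refine Finset.sum_congr rfl fun i _ => ?_
    rw [Algebra.TensorProduct.basis_apply, TensorProduct.smul_tmul', smul_eq_mul, mul_one]
  have hx' : x = ∑ i, m i ⊗ₜ[k] ((b i : V) : K) := by
    rw [← hyx, hy, map_sum]
    refine Finset.sum_congr rfl fun i _ => ?_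
    rw [LinearMap.lTensor_tmul]
    rfl
  -- exponents
  choose n μ hμ using fun i => hk' (m i)
  let M : ℕ := e + ∑ i, n i
  have hnM : ∀ i, n i ≤ M := fun i =>
    (Finset.single_le_sum (fun j _ => Nat.zero_le (n j)) (Finset.mem_univ i)).trans (Nat.le_add_left _ _)
  have hp1 : 1 < p := (Fact.out : p.Prime).one_lt
  have heM : e ≤ p ^ M := (Nat.le_add_right e _).trans (Nat.lt_pow_self hp1).le
  have hxq : x ^ p ^ M = 0 := pow_eq_zero_of_le heM he
  have hm : ∀ i, m i ^ p ^ M = algebraMap k k' (μ i ^ p ^ (M - n i)) := by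
    intro i
    rw [map_pow, hμ, ← pow_mul, ← pow_add, Nat.add_sub_cancel' (hnM i)]
  -- Frobenius: `x^q = 1 ⊗ Σ μᵢ' bᵢ^q`
  have hfrob : x ^ p ^ M =
      (1 : k') ⊗ₜ[k] (∑ i, (μ i ^ p ^ (M - n i)) • (((b i : V) : K) ^ p ^ M)) := by
    rw [hx', sum_pow_char_pow, TensorProduct.tmul_sum]
    refine Finset.sum_congr rfl fun i _ => ?_
    rw [Algebra.TensorProduct.tmul_pow, hm, Algebra.algebraMap_eq_smul_one, TensorProduct.smul_tmul]
  have hsum : ∑ i, (μ i ^ p ^ (M - n i)) • (((b i : V) : K) ^ p ^ M) = 0 := by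
    apply hinjT
    rw [map_zero]
    change (1 : k') ⊗ₜ[k] _ = 0
    rw [← hfrob, hxq]
  -- independence of the `bᵢ^q`
  have hbK : LinearIndependent k fun i => ((b i : V) : K) :=
    b.linearIndependent.map' V.subtype (Submodule.ker_subtype V)
  have hind := linearIndependent_pow_pow p H M _ hbK
  have hμ0 : ∀ i, μ i ^ p ^ (M - n i) = 0 := Fintype.linearIndependent_iff.mp hind _ hsum
  have hm0 : ∀ i, m i = 0 := fun i => by
    have h0 : m i ^ p ^ M = 0 := by rw [hm, hμ0, map_zero]
    exact IsNilpotent.eq_zero ⟨_, h0⟩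
  rw [← hyx, hy]
  simp [hm0]

end Literature.FieldTheory.Separability

end
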